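import Literature.AlgebraicGeometry.Frobenioids.BaseDegSquareComposition
import Literature.AlgebraicGeometry.Frobenioids.BaseDegEquivalence
import Literature.AlgebraicGeometry.Frobenioids.DivisorMonoidCategoryTheoreticityCorProofsV
import HarnessLib

/-!
# Frobenioids I, Corollary 4.12 — the tower over `F_{0_D}` with the equivalences supplied by
# Proposition 3.11 (i)

Mochizuki, *The geometry of Frobenioids I: the general theory*, Kyushu J. Math. **62** (2008)
293–400, kurims text proof of Cor. 4.12 p. 95: "the natural projection functors `C_i → F_{0_{D_i}}` may be
identified with the natural functors `C_i → C_i^birat → (C_i^birat)^un-tr` [cf. Proposition 3.11, (i)]"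
[cite: MochizukiFrdI2008, Cor. 4.12 p.95].

PROOF-ONLY. Binds the typed Prop. 3.11 (i) (`PreFrobenioidData.Prop311i`, seat abc-iut-L1-t3; turned into
"`U → D × N_{≥1}` is an equivalence" by `toBaseDeg_isEquivalence_of_prop311i`, `BaseDegEquivalence.lean`, seat
abc-iut-L1-d5) into the tower reduction of Cor. 4.12 (`BaseDegSquareComposition.cor412_of_tower`):

* `cor412_of_tower_of_prop311i` (generic `PreFrobenioidData`): Cor. 4.12 from a tower `C_i → U_i` factoring
  the projections, operations `SU_i` on `U_i` in the setting of Prop. 3.11 (zero monoid, FSMFF base,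
  isotropic, unit-trivial, group-like — print: `U_i = (C_i^birat)^un-tr`) satisfying the typed Prop. 3.11 (i),
  an equivalence `Ψ^U` over `Ψ` (Cor. 4.10 + Thm. 3.4 (iv)), Def. 1.3 (i)(a)(b)(c), (ii), (iv)(b) of `C₁ → D₁`
  and the rigidity of `Base₂ ∘ Ψ` on slim bases;
* `cor412_of_tower_of_prop311i'`: the same for Frobenioids `C_i → F_{Φ_i}`, where the Def. 1.3 clauses and the
  rigidity (Prop. 1.13 (i)) are theorems.

No statement of the paper is strengthened; nothing here is specific to the abc programme.
-/

namespace Literature.AlgebraicGeometry.Frobenioids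

open CategoryTheory Opposite

universe w w₁ w₂ w₃ w₄ v v' v₁ v₁' v₂ v₂' v₃ v₄ u u' u₁ u₁' u₂ u₂' u₃ u₄

namespace PreFrobenioidData

section Tower

variable {C₁ : Type u₁} [Category.{v₁} C₁] {D₁ : Type u₁'} [Category.{v₁'} D₁]
variable {C₂ : Type u₂} [Category.{v₂} C₂] {D₂ : Type u₂'} [Category.{v₂'} D₂]
variable {U₁ : Type u₃} [Category.{v₃} U₁] {U₂ : Type u₄} [Category.{v₄} U₂]
variable (S₁ : PreFrobenioidData.{w₁} C₁ D₁) (S₂ : PreFrobenioidData.{w₂} C₂ D₂) (Ψ : C₁ ≌ C₂)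
variable (SU₁ : PreFrobenioidData.{w₃} U₁ D₁) (SU₂ : PreFrobenioidData.{w₄} U₂ D₂)

/-- **Corollary 4.12 from the tower, the equivalences `U_i ⥲ D_i × N_{≥1}` supplied by Prop. 3.11 (i)**
(FrdI p. 95): as `cor412_of_tower`, with `SU_i` in the setting of Prop. 3.11 and satisfying the typed
Prop. 3.11 (i). [cite: MochizukiFrdI2008, Cor. 4.12 p.95] -/
theorem cor412_of_tower_of_prop311i (R₁ : S₁.RSParams) (R₂ : S₂.RSParams)
    (hbase : ∀ X : D₁, ∃ A : C₁, Nonempty (S₁.base.obj A ≅ X))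
    (hconn : ∀ (A B : C₁) (g : S₁.base.obj A ≅ S₁.base.obj B), ∃ (X : C₁) (φ : X ⟶ A) (ψ : X ⟶ B),
      IsIso (S₁.base.map φ) ∧ S₁.degFr φ = 1 ∧ S₁.degFr ψ = 1 ∧ S₁.base.map φ ≫ g.hom = S₁.base.map ψ)
    (hpb : ∀ (A : C₁) {Y : D₁} (f : Y ⟶ S₁.base.obj A),
      ∃ (A' : C₁) (φ : A' ⟶ A) (e : S₁.base.obj A' ≅ Y), S₁.base.map φ = e.hom ≫ f ∧ S₁.degFr φ = 1)
    (hfrob : ∀ (A : C₁) (n : ℕ+), ∃ (B : C₁) (γ : A ⟶ B), IsIso (S₁.base.map γ) ∧ S₁.degFr γ = n)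
    (T₁ : C₁ ⥤ U₁) (T₂ : C₂ ⥤ U₂) (ι₁ : T₁ ⋙ SU₁.toBaseDeg ≅ S₁.toBaseDeg)
    (ι₂ : T₂ ⋙ SU₂.toBaseDeg ≅ S₂.toBaseDeg)
    (hU₁ : Prop311Setting SU₁) (h311₁ : Prop311i SU₁) (hU₂ : Prop311Setting SU₂) (h311₂ : Prop311i SU₂)
    (ΨU : U₁ ≌ U₂) (hT : OneCommutes Ψ.functor T₂ T₁ ΨU.functor)
    (hrig : IsSlim D₁ → IsSlim D₂ → IsRigidFunctor (Ψ.functor ⋙ S₂.base)) : Cor412 S₁ S₂ Ψ R₁ R₂ := by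
  haveI := toBaseDeg_isEquivalence_of_prop311i SU₁ hU₁ h311₁
  haveI := toBaseDeg_isEquivalence_of_prop311i SU₂ hU₂ h311₂
  exact cor412_of_tower S₁ S₂ Ψ SU₁ SU₂ R₁ R₂ hbase hconn hpb hfrob T₁ T₂ ι₁ ι₂ ΨU hT hrig

end Tower

end PreFrobenioidData

namespace PreFrobenioid

section Tower

variable {D₁ : Type u} [Category.{v} D₁] {Φ₁ : D₁ᵒᵖ ⥤ CommMonCat.{w}}
  {C₁ : Type u'} [Category.{v'} C₁] (F₁ : C₁ ⥤ ElemFrobenioid Φ₁)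
  {D₂ : Type u} [Category.{v} D₂] {Φ₂ : D₂ᵒᵖ ⥤ CommMonCat.{w}}
  {C₂ : Type u'} [Category.{v'} C₂] (F₂ : C₂ ⥤ ElemFrobenioid Φ₂)
  (Ψ : C₁ ≌ C₂)
  {U₁ : Type u₃} [Category.{v₃} U₁] {U₂ : Type u₄} [Category.{v₄} U₂]
  (SU₁ : PreFrobenioidData.{w₃} U₁ D₁) (SU₂ : PreFrobenioidData.{w₄} U₂ D₂)

/-- **Corollary 4.12 for Frobenioids from the tower** (FrdI p. 95): a tower `C_i → U_i` factoring the projections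
`C_i → D_i × N_{≥1}`, operations `SU_i` in the setting of Prop. 3.11 satisfying the typed Prop. 3.11 (i)
(print: `U_i = (C_i^birat)^un-tr`), and an equivalence `Ψ^U : U₁ ⥲ U₂` over `Ψ` (Cor. 4.10 + Thm. 3.4 (iv))
give the typed Cor. 4.12 for `Ψ` — Def. 1.3 and Prop. 1.13 (i) being theorems for Frobenioids.
[cite: MochizukiFrdI2008, Cor. 4.12 p.95] -/
theorem cor412_of_tower_of_prop311i' (hF₁ : IsFrobenioid F₁) (hF₂ : IsFrobenioid F₂)
    (R₁ : (PreFrobenioidData.ofFunctor Φ₁ F₁).RSParams) (R₂ : (PreFrobenioidData.ofFunctor Φ₂ F₂).RSParams)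
    (T₁ : C₁ ⥤ U₁) (T₂ : C₂ ⥤ U₂) (ι₁ : T₁ ⋙ SU₁.toBaseDeg ≅ (PreFrobenioidData.ofFunctor Φ₁ F₁).toBaseDeg)
    (ι₂ : T₂ ⋙ SU₂.toBaseDeg ≅ (PreFrobenioidData.ofFunctor Φ₂ F₂).toBaseDeg)
    (hU₁ : PreFrobenioidData.Prop311Setting SU₁) (h311₁ : PreFrobenioidData.Prop311i SU₁)
    (hU₂ : PreFrobenioidData.Prop311Setting SU₂) (h311₂ : PreFrobenioidData.Prop311i SU₂)
    (ΨU : U₁ ≌ U₂) (hT : OneCommutes Ψ.functor T₂ T₁ ΨU.functor) :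
    (PreFrobenioidData.ofFunctor Φ₁ F₁).Cor412 (PreFrobenioidData.ofFunctor Φ₂ F₂) Ψ R₁ R₂ :=
  PreFrobenioidData.cor412_of_tower_of_prop311i _ _ Ψ SU₁ SU₂ R₁ R₂ (exists_base_iso_of_isFrobenioid F₁ hF₁)
    (exists_linear_preSteps_of_base_iso F₁ hF₁) (fun A _ f => exists_linear_arrow_over_base F₁ hF₁ A f)
    (exists_baseIso_of_degFr F₁ hF₁) T₁ T₂ ι₁ ι₂ hU₁ h311₁ hU₂ h311₂ ΨU hT
    (fun _ h₂ => IsRigidFunctor.comp_of_isEquivalence Ψ.functor (isRigidFunctor_baseFunctor hF₂ h₂))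

end Tower

end PreFrobenioid

end Literature.AlgebraicGeometry.Frobenioids
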